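import Mathlib
import HarnessLib
import Summits.CriticalPhenomena.PercolationContinuityZ3.Theorems.PercNearOneGluingNoHeavyLowerTailStarSetClassBalanced

/-!
# `NoHeavyLowerTail` (stmt-CriticalPhenomena-4575) — the pool bound for the I₀-group (U1-PROOF L7.3(ii))

Support file (prover `prim-gen-swap` gen 13; `--supports stmt-CriticalPhenomena-4575`).  No definitions, no named facts, no sorries.

This is the last analytic item of the seat memo U1-PROOF.md (the r-avoiding MWF supply inequality U1′_r, §7 "the pool",
Lemma L7.3(ii), proved in §7b): an abstract real inequality over a finite family `H` of "I-hot hubs" `X` with weights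
`x_X = t_X`, a "dominator" map `D : H → G` with fibres of size `≤ 2`, dominator weights `d_δ = t_δ ≥ 0`, the weight `T = t_{I₀}`,
and the constraints `0 ≤ x_X ≤ min(T, d_{D X})`.  With `s = Σ x`, `A = Σ x_X d_{D X}`, `e₂ = (s² − Σ x²)/2` and any
`P ≥ (1+T)·Π_X(1+x_X)·Π_δ(1+d_δ)`:

* `StarSet.pool_key_sq_le` — the key inequality `(T s + (1+T) A)² ≤ 2 T P (A + e₂)` ((★★) of U1-PROOF §7b);
* `StarSet.pool_hot_need_identity` — `Σ_X x_X (T + d + T d − P T d − ½ P T (s − x_X)) = (T s + (1+T)A) − T P (A + e₂)`;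
* `StarSet.pool_hot_need_sum_le_half` — hence that sum is `≤ 1/2` (`L − L²/2 ≤ 1/2`);
* `StarSet.pool_hot_need_posPart_le_half` — the form used by the ledger: with positive parts, any larger `s' ≥ s` and any
  larger `P`, `Σ_X x_X [T + d + T d − P T d − ½ P T (s' − x_X)]⁺ ≤ 1/2` (reduction to the sub-family of positive brackets).

The only combinatorial input is `s_δ := Σ_{D X = δ} x_X ≤ 2T` (at most two hubs per dominator, each `x ≤ T`), which gives
`(1+T) s_δ ≤ 2T (1 + s_δ)`; the product is bounded below by `Π_δ (1+d_δ)(1+s_δ) ≥ 1 + s + Σ_δ d_δ(1+s_δ)`.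
-/

namespace Summit.CriticalPhenomena.PercolationContinuityZ3.Theorems

open Finset
open scoped BigOperators

namespace StarSet

variable {ι κ : Type*}

/-- **Key inequality (★★) of U1-PROOF §7b: `(T s + (1+T) A)² ≤ 2 T P (A + e₂)`.** [U1-PROOF.md §7b] -/
theorem pool_key_sq_le [DecidableEq κ] (H : Finset ι) (G : Finset κ) (D : ι → κ) (hD : ∀ X ∈ H, D X ∈ G)
    (x : ι → ℝ) (d : κ → ℝ) (T P : ℝ) (hT : 0 ≤ T)
    (hx0 : ∀ X ∈ H, 0 ≤ x X) (hxT : ∀ X ∈ H, x X ≤ T) (hxd : ∀ X ∈ H, x X ≤ d (D X))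
    (hd0 : ∀ δ ∈ G, 0 ≤ d δ) (hfib : ∀ δ ∈ G, ({X ∈ H | D X = δ} : Finset ι).card ≤ 2)
    (hP : (1 + T) * ((∏ X ∈ H, (1 + x X)) * ∏ δ ∈ G, (1 + d δ)) ≤ P) :
    (T * ∑ X ∈ H, x X + (1 + T) * ∑ X ∈ H, x X * d (D X)) ^ 2 ≤
      2 * T * P * (∑ X ∈ H, x X * d (D X) + ((∑ X ∈ H, x X) ^ 2 - ∑ X ∈ H, x X ^ 2) / 2) := by
  classical
  -- fibre sums `s_δ`
  have hs_fib : ∑ δ ∈ G, ∑ X ∈ H with D X = δ, x X = ∑ X ∈ H, x X := sum_fiberwise_of_maps_to hD _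
  have hA_fib : ∑ δ ∈ G, (∑ X ∈ H with D X = δ, x X) * d δ = ∑ X ∈ H, x X * d (D X) := by
    rw [← sum_fiberwise_of_maps_to hD (fun X => x X * d (D X))]
    refine sum_congr rfl fun δ _ => ?_
    rw [sum_mul]
    refine sum_congr rfl fun X hX => ?_
    rw [(mem_filter.1 hX).2]
  have hsδ0 : ∀ δ ∈ G, 0 ≤ ∑ X ∈ H with D X = δ, x X :=
    fun δ _ => sum_nonneg fun X hX => hx0 X (mem_filter.1 hX).1
  have hsδT : ∀ δ ∈ G, ∑ X ∈ H with D X = δ, x X ≤ 2 * T := by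
    intro δ hδ
    have h1 : ∑ X ∈ H with D X = δ, x X ≤ ({X ∈ H | D X = δ} : Finset ι).card • T :=
      sum_le_card_nsmul _ _ _ (fun X hX => hxT X (mem_filter.1 hX).1)
    have h2 : (({X ∈ H | D X = δ} : Finset ι).card • T : ℝ) ≤ 2 * T := by
      rw [nsmul_eq_mul]
      exact mul_le_mul_of_nonneg_right (by exact_mod_cast hfib δ hδ) hT
    exact h1.trans h2
  -- the product bound `Π_X(1+x) Π_δ(1+d) ≥ 1 + s + M`, `M := Σ_δ d_δ (1 + s_δ)`
  have hprod_fib : ∏ δ ∈ G, ∏ X ∈ H with D X = δ, (1 + x X) = ∏ X ∈ H, (1 + x X) :=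
    prod_fiberwise_of_maps_to hD _
  have hM0 : 0 ≤ ∑ δ ∈ G, d δ * (1 + ∑ X ∈ H with D X = δ, x X) :=
    sum_nonneg fun δ hδ => mul_nonneg (hd0 δ hδ) (by linarith [hsδ0 δ hδ])
  have hQ : 1 + ∑ X ∈ H, x X + ∑ δ ∈ G, d δ * (1 + ∑ X ∈ H with D X = δ, x X) ≤
      (∏ X ∈ H, (1 + x X)) * ∏ δ ∈ G, (1 + d δ) := by
    rw [← hprod_fib, ← prod_mul_distrib]
    have hfac : ∀ δ ∈ G, 1 + ((∑ X ∈ H with D X = δ, x X) + d δ * (1 + ∑ X ∈ H with D X = δ, x X)) ≤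
        (∏ X ∈ H with D X = δ, (1 + x X)) * (1 + d δ) := by
      intro δ hδ
      have h1 : 1 + ∑ X ∈ H with D X = δ, x X ≤ ∏ X ∈ H with D X = δ, (1 + x X) :=
        one_add_sum_le_prod_one_add' _ _ (fun X hX => hx0 X (mem_filter.1 hX).1)
      have h2 : 0 ≤ 1 + d δ := by linarith [hd0 δ hδ]
      nlinarith [mul_le_mul_of_nonneg_right h1 h2, hsδ0 δ hδ, hd0 δ hδ]
    have hstep : 1 + ∑ δ ∈ G, ((∑ X ∈ H with D X = δ, x X) + d δ * (1 + ∑ X ∈ H with D X = δ, x X)) ≤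
        ∏ δ ∈ G, ((∏ X ∈ H with D X = δ, (1 + x X)) * (1 + d δ)) :=
      calc 1 + ∑ δ ∈ G, ((∑ X ∈ H with D X = δ, x X) + d δ * (1 + ∑ X ∈ H with D X = δ, x X))
          ≤ ∏ δ ∈ G, (1 + ((∑ X ∈ H with D X = δ, x X) + d δ * (1 + ∑ X ∈ H with D X = δ, x X))) :=
            one_add_sum_le_prod_one_add' _ _ (fun δ hδ => by nlinarith [hsδ0 δ hδ, hd0 δ hδ])
        _ ≤ _ := prod_le_prod (fun δ hδ => by nlinarith [hsδ0 δ hδ, hd0 δ hδ]) hfac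
    have hsplit : ∑ δ ∈ G, ((∑ X ∈ H with D X = δ, x X) + d δ * (1 + ∑ X ∈ H with D X = δ, x X)) =
        ∑ X ∈ H, x X + ∑ δ ∈ G, d δ * (1 + ∑ X ∈ H with D X = δ, x X) := by
      rw [sum_add_distrib, hs_fib]
    linarith
  -- `(1+T) A ≤ 2 T M`
  have hMA : (1 + T) * ∑ X ∈ H, x X * d (D X) ≤ 2 * T * ∑ δ ∈ G, d δ * (1 + ∑ X ∈ H with D X = δ, x X) := by
    rw [← hA_fib, mul_sum, mul_sum]
    refine sum_le_sum fun δ hδ => ?_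
    have h1 := hsδT δ hδ
    have h2 := hsδ0 δ hδ
    have h3 := hd0 δ hδ
    have h4 : (1 + T) * ∑ X ∈ H with D X = δ, x X ≤ 2 * T * (1 + ∑ X ∈ H with D X = δ, x X) := by nlinarith
    nlinarith [mul_le_mul_of_nonneg_left h4 h3]
  -- moments
  set s := ∑ X ∈ H, x X with hs
  set A := ∑ X ∈ H, x X * d (D X) with hA
  set S2 := ∑ X ∈ H, x X ^ 2 with hS2
  set M := ∑ δ ∈ G, d δ * (1 + ∑ X ∈ H with D X = δ, x X) with hM
  set Q := (∏ X ∈ H, (1 + x X)) * ∏ δ ∈ G, (1 + d δ) with hQdef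
  have hs0 : 0 ≤ s := sum_nonneg hx0
  have hS2A : S2 ≤ A := sum_le_sum fun X hX => by
    have := hxd X hX
    have := hx0 X hX
    nlinarith
  have hS20 : 0 ≤ S2 := sum_nonneg fun X _ => sq_nonneg _
  have hS2s : S2 ≤ s ^ 2 := by
    have hterm : ∀ X ∈ H, x X ^ 2 ≤ x X * s := fun X hX => by
      have hle : x X ≤ s := single_le_sum hx0 hX
      have := hx0 X hX
      nlinarith
    calc S2 ≤ ∑ X ∈ H, x X * s := sum_le_sum hterm
      _ = s ^ 2 := by rw [← sum_mul]; ring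
  have hA0 : 0 ≤ A := le_trans hS20 hS2A
  have hZ0 : 0 ≤ A + (s ^ 2 - S2) / 2 := by linarith
  have h1T : 0 ≤ 1 + T := by linarith
  -- the three termwise comparisons (a), (b), (c) of §7b
  have ha : T ^ 2 * s ^ 2 ≤ 2 * T * (1 + T) * (A + (s ^ 2 - S2) / 2) := by
    nlinarith [mul_nonneg (mul_nonneg hT h1T) (sub_nonneg.2 hS2A), mul_nonneg hT (sq_nonneg s),
      mul_nonneg (mul_nonneg hT h1T) hS20]
  have hb : 0 ≤ 2 * T * (1 + T) * s * ((s ^ 2 - S2) / 2) :=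
    mul_nonneg (mul_nonneg (mul_nonneg (mul_nonneg (by norm_num) hT) h1T) hs0) (by linarith)
  have hc : (1 + T) ^ 2 * A ^ 2 ≤ 2 * T * (1 + T) * M * (A + (s ^ 2 - S2) / 2) := by
    have h1 : 0 ≤ (1 + T) * A * (2 * T * M - (1 + T) * A) :=
      mul_nonneg (mul_nonneg h1T hA0) (by linarith)
    have h2 : 0 ≤ 2 * T * (1 + T) * M * ((s ^ 2 - S2) / 2) :=
      mul_nonneg (mul_nonneg (mul_nonneg (mul_nonneg (by norm_num) hT) h1T) hM0) (by linarith)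
    nlinarith
  have key : (T * s + (1 + T) * A) ^ 2 ≤ 2 * T * ((1 + T) * (1 + s + M)) * (A + (s ^ 2 - S2) / 2) := by
    nlinarith
  have hmono : 2 * T * ((1 + T) * (1 + s + M)) * (A + (s ^ 2 - S2) / 2) ≤
      2 * T * P * (A + (s ^ 2 - S2) / 2) := by
    have hle : (1 + T) * (1 + s + M) ≤ P := le_trans (mul_le_mul_of_nonneg_left hQ h1T) hP
    have h2T : 0 ≤ 2 * T := by linarith
    exact mul_le_mul_of_nonneg_right (mul_le_mul_of_nonneg_left hle h2T) hZ0
  exact key.trans hmono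

/-- The I₀-group need as two moments: `Σ_X x_X (T + d + T d − P T d − ½ P T (s − x_X)) = (T s + (1+T) A) − T P (A + e₂)`.
[U1-PROOF.md §7b Step 1] -/
theorem pool_hot_need_identity (H : Finset ι) (D : ι → κ) (x : ι → ℝ) (d : κ → ℝ) (T P : ℝ) :
    ∑ X ∈ H, x X * (T + d (D X) + T * d (D X) - P * T * d (D X) - P * T * ((∑ Y ∈ H, x Y) - x X) / 2) =
      (T * ∑ X ∈ H, x X + (1 + T) * ∑ X ∈ H, x X * d (D X)) -
        T * P * (∑ X ∈ H, x X * d (D X) + ((∑ X ∈ H, x X) ^ 2 - ∑ X ∈ H, x X ^ 2) / 2) := by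
  have hterm : ∀ X ∈ H, x X * (T + d (D X) + T * d (D X) - P * T * d (D X) - P * T * ((∑ Y ∈ H, x Y) - x X) / 2) =
      T * x X + (1 + T) * (x X * d (D X)) - P * T * (x X * d (D X)) - (P * T * (∑ Y ∈ H, x Y) / 2) * x X +
        (P * T / 2) * x X ^ 2 := fun X _ => by ring
  rw [sum_congr rfl hterm, sum_add_distrib, sum_sub_distrib, sum_sub_distrib, sum_add_distrib, ← mul_sum, ← mul_sum,
    ← mul_sum, ← mul_sum, ← mul_sum]
  ring

/-- **L7.3(ii), family form: `Σ_X x_X (T + d + T d − P T d − ½ P T (s − x_X)) ≤ 1/2`** for every family of hubs with at most two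
hubs per dominator, `0 ≤ x ≤ min(T, d)`, and `P ≥ (1+T) Π(1+x) Π(1+d)`. [U1-PROOF.md §7b] -/
theorem pool_hot_need_sum_le_half [DecidableEq κ] (H : Finset ι) (G : Finset κ) (D : ι → κ) (hD : ∀ X ∈ H, D X ∈ G)
    (x : ι → ℝ) (d : κ → ℝ) (T P : ℝ) (hT : 0 ≤ T)
    (hx0 : ∀ X ∈ H, 0 ≤ x X) (hxT : ∀ X ∈ H, x X ≤ T) (hxd : ∀ X ∈ H, x X ≤ d (D X))
    (hd0 : ∀ δ ∈ G, 0 ≤ d δ) (hfib : ∀ δ ∈ G, ({X ∈ H | D X = δ} : Finset ι).card ≤ 2)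
    (hP : (1 + T) * ((∏ X ∈ H, (1 + x X)) * ∏ δ ∈ G, (1 + d δ)) ≤ P) :
    ∑ X ∈ H, x X * (T + d (D X) + T * d (D X) - P * T * d (D X) - P * T * ((∑ Y ∈ H, x Y) - x X) / 2) ≤ 1 / 2 := by
  rw [pool_hot_need_identity]
  have key := pool_key_sq_le H G D hD x d T P hT hx0 hxT hxd hd0 hfib hP
  nlinarith [sq_nonneg (T * ∑ X ∈ H, x X + (1 + T) * ∑ X ∈ H, x X * d (D X) - 1)]

/-- **L7.3(ii) as used by the ledger: `Σ_X x_X [T + d + T d − P T d − ½ P T (s' − x_X)]⁺ ≤ 1/2`** for every `s' ≥ Σ x` and every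
`P ≥ (1+T) Π_X(1+x_X) Π_δ(1+d_δ)` (reduction to the sub-family of hubs with positive bracket, on which the bracket only grows when
`s'` and `P` are replaced by the sub-family's own `s` and product). [U1-PROOF.md §7b Step 0] -/
theorem pool_hot_need_posPart_le_half [DecidableEq κ] (H : Finset ι) (G : Finset κ) (D : ι → κ) (hD : ∀ X ∈ H, D X ∈ G)
    (x : ι → ℝ) (d : κ → ℝ) (T P s' : ℝ) (hT : 0 ≤ T)
    (hx0 : ∀ X ∈ H, 0 ≤ x X) (hxT : ∀ X ∈ H, x X ≤ T) (hxd : ∀ X ∈ H, x X ≤ d (D X))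
    (hd0 : ∀ δ ∈ G, 0 ≤ d δ) (hfib : ∀ δ ∈ G, ({X ∈ H | D X = δ} : Finset ι).card ≤ 2)
    (hP : (1 + T) * ((∏ X ∈ H, (1 + x X)) * ∏ δ ∈ G, (1 + d δ)) ≤ P) (hs' : ∑ X ∈ H, x X ≤ s') :
    ∑ X ∈ H, x X * max 0 (T + d (D X) + T * d (D X) - P * T * d (D X) - P * T * (s' - x X) / 2) ≤ 1 / 2 := by
  classical
  -- the sub-family of positive brackets
  set Hp : Finset ι := {X ∈ H | 0 < T + d (D X) + T * d (D X) - P * T * d (D X) - P * T * (s' - x X) / 2} with hHp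
  have hsub : Hp ⊆ H := filter_subset _ _
  have hsplit : ∑ X ∈ H, x X * max 0 (T + d (D X) + T * d (D X) - P * T * d (D X) - P * T * (s' - x X) / 2) =
      ∑ X ∈ Hp, x X * (T + d (D X) + T * d (D X) - P * T * d (D X) - P * T * (s' - x X) / 2) := by
    rw [← sum_filter_add_sum_filter_not H
      (fun X => 0 < T + d (D X) + T * d (D X) - P * T * d (D X) - P * T * (s' - x X) / 2)]
    have hzero : ∑ X ∈ H with ¬ (0 < T + d (D X) + T * d (D X) - P * T * d (D X) - P * T * (s' - x X) / 2),
        x X * max 0 (T + d (D X) + T * d (D X) - P * T * d (D X) - P * T * (s' - x X) / 2) = 0 := by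
      refine sum_eq_zero fun X hX => ?_
      have hle := (mem_filter.1 hX).2
      rw [max_eq_left (not_lt.1 hle), mul_zero]
    rw [hzero, add_zero]
    refine sum_congr rfl fun X hX => ?_
    rw [max_eq_right (le_of_lt (mem_filter.1 hX).2)]
  rw [hsplit]
  -- the sub-family's own `s` and product are smaller, so its brackets are larger
  set Pp := (1 + T) * ((∏ X ∈ Hp, (1 + x X)) * ∏ δ ∈ G, (1 + d δ)) with hPp
  have h1T : 0 ≤ 1 + T := by linarith
  have hG0 : 0 ≤ ∏ δ ∈ G, (1 + d δ) := prod_nonneg fun δ hδ => by linarith [hd0 δ hδ]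
  have hPp_le : Pp ≤ P := by
    refine le_trans ?_ hP
    have hdecomp := prod_filter_mul_prod_filter_not H
      (fun X => 0 < T + d (D X) + T * d (D X) - P * T * d (D X) - P * T * (s' - x X) / 2) (fun X => 1 + x X)
    have hrest : 1 ≤ ∏ X ∈ H with ¬ (0 < T + d (D X) + T * d (D X) - P * T * d (D X) - P * T * (s' - x X) / 2),
        (1 + x X) :=
      le_trans (by linarith [sum_nonneg fun X (hX : X ∈ {X ∈ H | ¬ (0 < T + d (D X) + T * d (D X) - P * T * d (D X) -
          P * T * (s' - x X) / 2)}) => hx0 X (mem_filter.1 hX).1])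
        (one_add_sum_le_prod_one_add' _ _ fun X hX => hx0 X (mem_filter.1 hX).1)
    have hp0 : 0 ≤ ∏ X ∈ Hp, (1 + x X) := prod_nonneg fun X hX => by linarith [hx0 X (hsub hX)]
    have h1 : ∏ X ∈ Hp, (1 + x X) ≤ ∏ X ∈ H, (1 + x X) :=
      calc ∏ X ∈ Hp, (1 + x X) = (∏ X ∈ Hp, (1 + x X)) * 1 := (mul_one _).symm
        _ ≤ (∏ X ∈ Hp, (1 + x X)) * ∏ X ∈ H with ¬ (0 < T + d (D X) + T * d (D X) - P * T * d (D X) -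
              P * T * (s' - x X) / 2), (1 + x X) := mul_le_mul_of_nonneg_left hrest hp0
        _ = ∏ X ∈ H, (1 + x X) := hdecomp
    exact mul_le_mul_of_nonneg_left (mul_le_mul_of_nonneg_right h1 hG0) h1T
  have hPp0 : 0 ≤ Pp :=
    mul_nonneg h1T (mul_nonneg (prod_nonneg fun X hX => by linarith [hx0 X (hsub hX)]) hG0)
  have hP0 : 0 ≤ P := hPp0.trans hPp_le
  have hsp_le : ∑ X ∈ Hp, x X ≤ s' := le_trans (sum_le_sum_of_subset_of_nonneg hsub fun X hX _ => hx0 X hX) hs'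
  have hmono : ∀ X ∈ Hp, x X * (T + d (D X) + T * d (D X) - P * T * d (D X) - P * T * (s' - x X) / 2) ≤
      x X * (T + d (D X) + T * d (D X) - Pp * T * d (D X) - Pp * T * ((∑ Y ∈ Hp, x Y) - x X) / 2) := by
    intro X hX
    have hXH : X ∈ H := hsub hX
    have hxX := hx0 X hXH
    have hdX : 0 ≤ d (D X) := hd0 _ (hD X hXH)
    have hxs : x X ≤ ∑ Y ∈ Hp, x Y := single_le_sum (fun Y hY => hx0 Y (hsub hY)) hX
    refine mul_le_mul_of_nonneg_left ?_ hxX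
    -- bracket antitone in `P` and in `s'`
    have h1 : Pp * T * (d (D X) + ((∑ Y ∈ Hp, x Y) - x X) / 2) ≤ P * T * (d (D X) + ((∑ Y ∈ Hp, x Y) - x X) / 2) :=
      mul_le_mul_of_nonneg_right (mul_le_mul_of_nonneg_right hPp_le hT) (by linarith)
    have h2 : P * T * (((∑ Y ∈ Hp, x Y) - x X) / 2) ≤ P * T * ((s' - x X) / 2) := by
      have hPT : 0 ≤ P * T := mul_nonneg hP0 hT
      exact mul_le_mul_of_nonneg_left (by linarith) hPT
    nlinarith
  refine le_trans (sum_le_sum hmono) ?_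
  have hfib' : ∀ δ ∈ G, ({X ∈ Hp | D X = δ} : Finset ι).card ≤ 2 := fun δ hδ =>
    le_trans (card_le_card (fun X hX => by
      rw [mem_filter] at hX ⊢
      exact ⟨hsub hX.1, hX.2⟩)) (hfib δ hδ)
  exact pool_hot_need_sum_le_half Hp G D (fun X hX => hD X (hsub hX)) x d T Pp hT
    (fun X hX => hx0 X (hsub hX)) (fun X hX => hxT X (hsub hX)) (fun X hX => hxd X (hsub hX)) hd0 hfib' le_rfl

end StarSet

end Summit.CriticalPhenomena.PercolationContinuityZ3.Theorems
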